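import Literature.NumberTheory.LFunctions.HalaszMeanSquare
import HarnessLib

/-!
# Granville–Soundararajan 2003: the twisted Mellin–Plancherel identity and Lemma 2.2 (2.6)

Ingredients of the proof of **Theorem 4** of A. Granville, K. Soundararajan, *Decay of mean values
of multiplicative functions*, Canad. J. Math. 55 (2003) (the twisted Lipschitz estimate, §6 of the
paper), which rests on Proposition 3.3 — the variant of Proposition 1 in which the partial sums
`S(y)` are replaced by the differences `S(y)/y - S(y/w)/(y/w)` (`w ≥ 1` real) — and on (2.6) of
Lemma 2.2.  For a Dirichlet series `L(s) = ∑ a_n n^{-s}` with `∑ |a_n| n^{-σ} < ∞` and partial sums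
`A(y) = ∑_{n ≤ y} a_n`:

* `integral_norm_sq_psum_sub_exp` — the **twisted Mellin–Plancherel identity**
  `∫_ℝ |A(e^u) - w A(e^u/w)|² e^{-2σu} du = (1/2π) ∫_ℝ |L(σ+iy)|² |1 - w^{1-σ-iy}|²/|σ+iy|² dy`
  (the Fourier transform of `e^{-σt}(A(e^t) - wA(e^t/w))` is `L(s)(1 - w^{1-s})/s`, as stated in
  the proof of Proposition 3.3; from the tree's `MellinPlancherel.fourier_phi` and translation);
* `norm_twist_le_two` etc. — the twist factor `|1 - w^{1-s}| ≤ 2` on `Re s ≥ 1`;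
* `norm_LSeries_twist_le_of_bound` — **Lemma 2.2, (2.6)**: if `|L(σ₀+iu)(1 - w^{-iu})| ≤ B` for
  `|u| ≤ |y| + T₀` then `|L(σ₀+α+iy)(1 - w^{-α-iy})| ≤ B + (4α/T₀) ∑ |a_n| n^{-σ₀}` (Poisson kernel,
  as in the tree's `PoissonSmoothing.norm_LSeries_le_of_bound` for (2.5), using
  `z^{-α} = ∫ K_α(u) z^{-iu} du` also at the real points `z = nw`).

The twisted form of (3.8) + Lemma 3.2 (the inner integral of Proposition 3.3) is in
`GranvilleSoundararajanTwistedMeanSquare.lean`.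

## References
- [GranvilleSoundararajan2003] A. Granville, K. Soundararajan, *Decay of mean values of
  multiplicative functions*, Canad. J. Math. 55 (2003), 1191–1230: Lemma 2.2 and its proof ((2.6)),
  Proposition 3.3 and its proof; arXiv math/9911246 pp. 5, 8.

## Design choices
* The twist factor on `Re s = 1 + α` is written `1 - (w : ℂ) ^ (1 - (1 + α + y I))`; in (2.6) it is
  `1 - (w : ℂ) ^ (-(α + y I))` (the two agree by `ring`).  No definitions are introduced.
-/

noncomputable section

open Finset Real Complex MeasureTheory Set Filter FourierTransform

namespace Literature.NumberTheory.LFunctions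

namespace GranvilleSoundararajan

open MellinPlancherel (psum phi)
open PoissonSmoothing (kernel)

/-! ### The twisted Mellin–Plancherel identity -/

section TwistedPlancherel

variable {a : ℕ → ℂ} {σ θ C : ℝ}

/-- With `φ(u) = e^{-σu} A(e^u)` (`MellinPlancherel.phi`), the twisted function
`ψ(u) = φ(u) - c φ(u - L)` is integrable under the growth bound `|A(y)| ≤ C y^θ`, `θ < σ`. [folklore] -/
theorem integrable_phi_sub_translate (hbd : ∀ y : ℝ, 1 ≤ y → ‖psum a y‖ ≤ C * y ^ θ) (hθ : θ < σ)
    (c : ℂ) (L : ℝ) : Integrable (fun u => phi a σ u - c * phi a σ (u - L)) := by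
  have h1 := MellinPlancherel.integrable_phi hbd hθ
  have h2 : Integrable (fun u => phi a σ (u - L)) := h1.comp_sub_right L
  exact h1.sub (h2.const_mul c)

/-- `|ψ(u)| ≤ C + |c| C` for the twisted function `ψ(u) = φ(u) - c φ(u - L)`. [folklore] -/
theorem norm_phi_sub_translate_le (hbd : ∀ y : ℝ, 1 ≤ y → ‖psum a y‖ ≤ C * y ^ θ) (hθ : θ < σ) (c : ℂ)
    (L : ℝ) (u : ℝ) : ‖phi a σ u - c * phi a σ (u - L)‖ ≤ C + ‖c‖ * C := by
  have h1 := MellinPlancherel.norm_phi_le_const hbd hθ u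
  have h2 := MellinPlancherel.norm_phi_le_const hbd hθ (u - L)
  calc ‖phi a σ u - c * phi a σ (u - L)‖ ≤ ‖phi a σ u‖ + ‖c * phi a σ (u - L)‖ := norm_sub_le _ _
    _ ≤ C + ‖c‖ * C := by rw [norm_mul]; gcongr

/-- The twisted function `ψ(u) = φ(u) - c φ(u - L)` is in `L²` (bounded and integrable). [folklore] -/
theorem memLp_two_phi_sub_translate (hbd : ∀ y : ℝ, 1 ≤ y → ‖psum a y‖ ≤ C * y ^ θ) (hθ : θ < σ)
    (c : ℂ) (L : ℝ) : MemLp (fun u => phi a σ u - c * phi a σ (u - L)) 2 :=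
  WindowPlancherel.memLp_two_of_norm_le (integrable_phi_sub_translate hbd hθ c L)
    (norm_phi_sub_translate_le hbd hθ c L)

/-- The Fourier transform of the twisted function `ψ(u) = φ(u) - c φ(u - L)`:
`𝓕ψ(ξ) = 𝓕φ(ξ) (1 - c e(-Lξ))` (translation becomes a phase). [folklore] -/
theorem fourier_phi_sub_translate (hbd : ∀ y : ℝ, 1 ≤ y → ‖psum a y‖ ≤ C * y ^ θ) (hθ : θ < σ) (c : ℂ)
    (L : ℝ) (ξ : ℝ) :
    𝓕 (fun u => phi a σ u - c * phi a σ (u - L)) ξ = 𝓕 (phi a σ) ξ * (1 - c * (𝐞 (-(L * ξ)) : ℂ)) := by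
  have hint := MellinPlancherel.integrable_phi hbd hθ
  -- integrability of the Fourier integrands
  have hb : MemLp (fun v : ℝ => ((𝐞 (-(v * ξ)) : Circle) : ℂ)) ⊤ volume := by
    refine memLp_top_of_bound (by fun_prop) 1 (Filter.Eventually.of_forall fun v => ?_)
    simp
  have hI1 : Integrable (fun v : ℝ => ((𝐞 (-(v * ξ)) : Circle) : ℂ) * phi a σ v) := by
    have := hint.smul_of_top_left hb
    exact this.congr (Filter.Eventually.of_forall fun v => by simp [mul_comm])
  have hI2 : Integrable (fun v : ℝ => ((𝐞 (-(v * ξ)) : Circle) : ℂ) * (c * phi a σ (v - L))) := by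
    have h2 : Integrable (fun u => c * phi a σ (u - L)) := (hint.comp_sub_right L).const_mul c
    have := h2.smul_of_top_left hb
    exact this.congr (Filter.Eventually.of_forall fun v => by simp [mul_comm])
  rw [Real.fourier_real_eq, Real.fourier_real_eq]
  simp only [Circle.smul_def, smul_eq_mul]
  have hsplit : (fun v : ℝ => ((𝐞 (-(v * ξ)) : Circle) : ℂ) * (phi a σ v - c * phi a σ (v - L))) =
      fun v => ((𝐞 (-(v * ξ)) : Circle) : ℂ) * phi a σ v - ((𝐞 (-(v * ξ)) : Circle) : ℂ) * (c * phi a σ (v - L)) := by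
    funext v; ring
  rw [hsplit, integral_sub hI1 hI2]
  -- the translated integral
  have htrans : ∫ v : ℝ, ((𝐞 (-(v * ξ)) : Circle) : ℂ) * (c * phi a σ (v - L)) =
      c * (𝐞 (-(L * ξ)) : ℂ) * ∫ v : ℝ, ((𝐞 (-(v * ξ)) : Circle) : ℂ) * phi a σ v := by
    have hpt : ∀ v : ℝ, ((𝐞 (-(v * ξ)) : Circle) : ℂ) * (c * phi a σ (v - L)) =
        c * (𝐞 (-(L * ξ)) : ℂ) * (((𝐞 (-((v - L) * ξ)) : Circle) : ℂ) * phi a σ (v - L)) := by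
      intro v
      have he : ((𝐞 (-(v * ξ)) : Circle) : ℂ) = (𝐞 (-(L * ξ)) : ℂ) * ((𝐞 (-((v - L) * ξ)) : Circle) : ℂ) := by
        rw [← Circle.coe_mul, ← AddChar.map_add_eq_mul]
        congr 2; ring
      rw [he]; ring
    simp_rw [hpt]
    rw [integral_const_mul]
    congr 1
    exact integral_sub_right_eq_self (fun u : ℝ => ((𝐞 (-(u * ξ)) : Circle) : ℂ) * phi a σ u) L
  rw [htrans]
  ring

/-- **Twisted Mellin–Plancherel**: for `ℓ¹`-weighted coefficients (`∑ |a_n| n^{-σ} < ∞`, `σ > 0`)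
with `|A(y)| ≤ C y^θ` (`θ < σ`) and real `w > 0`,
`∫ |A(e^u) - w A(e^u/w)|² e^{-2σu} du = (1/2π) ∫ |L(σ+iy)|² |1 - w^{1-σ-iy}|²/|σ+iy|² dy`.
[cite: GranvilleSoundararajan2003, proof of Proposition 3.3] -/
theorem integral_norm_sq_psum_sub_exp (hσ : 0 < σ) (hsum : Summable fun n : ℕ => ‖a n‖ / (n : ℝ) ^ σ)
    (hθ : θ < σ) (hbd : ∀ y : ℝ, 1 ≤ y → ‖psum a y‖ ≤ C * y ^ θ) {w : ℝ} (hw : 0 < w) :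
    ∫ u : ℝ, ‖psum a (Real.exp u) - (w : ℂ) * psum a (Real.exp u / w)‖ ^ 2 * Real.exp (-(2 * σ * u)) =
      (1 / (2 * π)) * ∫ y : ℝ, ‖LSeries a (σ + y * I)‖ ^ 2 *
        ‖1 - (w : ℂ) ^ (1 - ((σ : ℂ) + y * I))‖ ^ 2 / ‖(σ : ℂ) + y * I‖ ^ 2 := by
  set c : ℂ := ((w ^ (1 - σ) : ℝ) : ℂ) with hc
  set L : ℝ := Real.log w with hL
  have hP := Literature.Analysis.FunctionSpaces.integral_norm_sq_fourierIntegral_eq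
    (integrable_phi_sub_translate hbd hθ c L) (memLp_two_phi_sub_translate hbd hθ c L)
  -- the `u`-side
  have hR : ∫ u : ℝ, ‖phi a σ u - c * phi a σ (u - L)‖ ^ 2 =
      ∫ u : ℝ, ‖psum a (Real.exp u) - (w : ℂ) * psum a (Real.exp u / w)‖ ^ 2 * Real.exp (-(2 * σ * u)) := by
    refine integral_congr_ae (Filter.Eventually.of_forall fun u => ?_)
    simp only [MellinPlancherel.phi]
    have hexp : Real.exp (u - L) = Real.exp u / w := by
      rw [Real.exp_sub, hL, Real.exp_log hw]
    have hcw : c * (Real.exp (-(σ * (u - L))) : ℂ) = (w : ℂ) * (Real.exp (-(σ * u)) : ℂ) := by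
      rw [hc, ← Complex.ofReal_mul, ← Complex.ofReal_mul]
      congr 1
      rw [show -(σ * (u - L)) = -(σ * u) + σ * L by ring, Real.exp_add, hL,
        show σ * Real.log w = Real.log w * σ by ring, ← Real.rpow_def_of_pos hw]
      have : w ^ (1 - σ) * w ^ σ = w := by
        rw [← Real.rpow_add hw]; norm_num
      calc w ^ (1 - σ) * (Real.exp (-(σ * u)) * w ^ σ) = (w ^ (1 - σ) * w ^ σ) * Real.exp (-(σ * u)) := by ring
        _ = w * Real.exp (-(σ * u)) := by rw [this]
    rw [hexp, ← mul_assoc, hcw]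
    rw [show (Real.exp (-(σ * u)) : ℂ) * psum a (Real.exp u) - (w : ℂ) * (Real.exp (-(σ * u)) : ℂ) * psum a (Real.exp u / w)
        = (Real.exp (-(σ * u)) : ℂ) * (psum a (Real.exp u) - (w : ℂ) * psum a (Real.exp u / w)) by ring]
    rw [norm_mul, Complex.norm_real, Real.norm_of_nonneg (Real.exp_pos _).le, mul_pow, ← Real.exp_nat_mul]
    ring_nf
  -- the `ξ`-side
  set G : ℝ → ℝ := fun y => ‖LSeries a (σ + y * I)‖ ^ 2 *
    ‖1 - (w : ℂ) ^ (1 - ((σ : ℂ) + y * I))‖ ^ 2 / ‖(σ : ℂ) + y * I‖ ^ 2 with hG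
  have hLfour : ∫ ξ : ℝ, ‖𝓕 (fun u => phi a σ u - c * phi a σ (u - L)) ξ‖ ^ 2 = ∫ ξ : ℝ, G ((2 * π) * ξ) := by
    refine integral_congr_ae (Filter.Eventually.of_forall fun ξ => ?_)
    simp only [hG]
    rw [fourier_phi_sub_translate hbd hθ c L, MellinPlancherel.fourier_phi hσ hsum, norm_mul, norm_div, mul_pow, div_pow]
    have hcw : c * (𝐞 (-(L * ξ)) : ℂ) = (w : ℂ) ^ (1 - ((σ : ℂ) + ((2 * π * ξ : ℝ) : ℂ) * I)) := by
      have hw0 : (w : ℂ) ≠ 0 := by exact_mod_cast hw.ne'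
      rw [Real.fourierChar_apply, hc, hL, Complex.ofReal_cpow hw.le, Complex.cpow_def_of_ne_zero hw0,
        Complex.cpow_def_of_ne_zero hw0, ← Complex.ofReal_log hw.le, ← Complex.exp_add]
      congr 1
      push_cast
      ring
    rw [hcw]
    push_cast
    ring
  have h2π : |(2 * π)⁻¹| = 1 / (2 * π) := by rw [abs_of_pos (by positivity), one_div]
  rw [← hR, ← hP, hLfour, Measure.integral_comp_mul_left G, h2π, smul_eq_mul]

end TwistedPlancherel

/-! ### The twist factor `1 - w^{1-s}` -/

/-- `‖w^z‖ = w^{Re z} ≤ 1` for real `w ≥ 1` and `Re z ≤ 0`. [folklore] -/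
theorem norm_cpow_le_one_of_re_nonpos {w : ℝ} (hw : 1 ≤ w) {z : ℂ} (hz : z.re ≤ 0) :
    ‖(w : ℂ) ^ z‖ ≤ 1 := by
  rw [Complex.norm_cpow_eq_rpow_re_of_pos (by linarith) z]
  exact Real.rpow_le_one_of_one_le_of_nonpos hw hz

/-- `‖1 - w^z‖ ≤ 2` for real `w ≥ 1` and `Re z ≤ 0`. [folklore] -/
theorem norm_one_sub_cpow_le_two {w : ℝ} (hw : 1 ≤ w) {z : ℂ} (hz : z.re ≤ 0) :
    ‖1 - (w : ℂ) ^ z‖ ≤ 2 := by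
  calc ‖1 - (w : ℂ) ^ z‖ ≤ ‖(1 : ℂ)‖ + ‖(w : ℂ) ^ z‖ := norm_sub_le _ _
    _ ≤ 1 + 1 := by rw [norm_one]; gcongr; exact norm_cpow_le_one_of_re_nonpos hw hz
    _ = 2 := by norm_num

/-- The twist factor on the line `Re s = 1 + α`: `‖1 - w^{1-s}‖ ≤ 2` (`w ≥ 1`, `α ≥ 0`). [folklore] -/
theorem norm_twist_le_two {w : ℝ} (hw : 1 ≤ w) {α : ℝ} (hα : 0 ≤ α) (y : ℝ) :
    ‖1 - (w : ℂ) ^ (1 - ((1 : ℂ) + α + y * I))‖ ≤ 2 :=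
  norm_one_sub_cpow_le_two hw (by simp; linarith)

/-- `y ↦ w^{1-(1+α+iy)}` is continuous (`w > 0`). [folklore] -/
theorem continuous_twist {w : ℝ} (hw : 0 < w) (α : ℝ) :
    Continuous fun y : ℝ => (1 : ℂ) - (w : ℂ) ^ (1 - ((1 : ℂ) + α + y * I)) := by
  refine continuous_const.sub ?_
  refine Continuous.const_cpow (by fun_prop) (Or.inl ?_)
  exact_mod_cast hw.ne'

/-! ### Lemma 2.2, (2.6): Poisson smoothing of the twisted Dirichlet series -/

section TwistedSmoothing

variable {α : ℝ} (hα : 0 < α)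
include hα

/-- For real `z ≥ 1`: `z^{-α} = ∫ K_α(u) z^{-iu} du`. [folklore] -/
theorem ofReal_cpow_neg_eq_integral {z : ℝ} (hz : 1 ≤ z) :
    ((z : ℂ)) ^ (-(α : ℂ)) = ∫ u : ℝ, (kernel α u : ℂ) * (z : ℂ) ^ (-((u : ℂ) * I)) := by
  have hz0 : (z : ℂ) ≠ 0 := by exact_mod_cast (show z ≠ 0 by linarith)
  have hlog : 0 ≤ Real.log z := Real.log_nonneg hz
  have h := PoissonSmoothing.integral_kernel_mul_exp hα (Real.log z)
  rw [abs_of_nonneg hlog] at h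
  have hL : ((z : ℂ)) ^ (-(α : ℂ)) = (Real.exp (-(α * Real.log z)) : ℂ) := by
    rw [Complex.cpow_def_of_ne_zero hz0, ← Complex.ofReal_log (by linarith), Complex.ofReal_exp]
    congr 1; push_cast; ring
  rw [hL, ← h]
  refine integral_congr_ae (Filter.Eventually.of_forall fun u => ?_)
  simp only
  congr 1
  rw [Complex.cpow_def_of_ne_zero hz0, ← Complex.ofReal_log (by linarith)]
  congr 1; push_cast; ring

omit hα in
/-- `‖z^{-iu}‖ = 1` for real `z > 0`. [folklore] -/
theorem norm_ofReal_cpow_neg_mul_I {z : ℝ} (hz : 0 < z) (u : ℝ) : ‖(z : ℂ) ^ (-((u : ℂ) * I))‖ = 1 := by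
  rw [Complex.norm_cpow_eq_rpow_re_of_pos hz]
  simp

omit hα in
/-- `‖1 - w^{-iu}‖ ≤ 2` for real `w ≥ 1`. [folklore] -/
theorem norm_one_sub_cpow_neg_mul_I_le {w : ℝ} (hw : 1 ≤ w) (u : ℝ) : ‖1 - (w : ℂ) ^ (-((u : ℂ) * I))‖ ≤ 2 := by
  calc ‖1 - (w : ℂ) ^ (-((u : ℂ) * I))‖ ≤ ‖(1 : ℂ)‖ + ‖(w : ℂ) ^ (-((u : ℂ) * I))‖ := norm_sub_le _ _
    _ = 2 := by rw [norm_one, norm_ofReal_cpow_neg_mul_I (by linarith) u]; norm_num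

/-- The key representation, twisted: for `n ≥ 1`, `w ≥ 1`,
`a_n n^{-(σ₀+α+iy)} (1 - w^{-α-iy}) = ∫ K_α(u) a_n n^{-(σ₀ + i(y+u))} (1 - w^{-i(y+u)}) du`.
[cite: GranvilleSoundararajan2003, proof of Lemma 2.2 (display before (2.6))] -/
theorem term_twist_eq_integral {a : ℕ → ℂ} {σ₀ : ℝ} {w : ℝ} (hw : 1 ≤ w) (y : ℝ) {n : ℕ} (hn : 1 ≤ n) :
    LSeries.term a (σ₀ + α + y * I) n * (1 - (w : ℂ) ^ (-((α : ℂ) + y * I))) =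
      ∫ u : ℝ, (kernel α u : ℂ) * (LSeries.term a (σ₀ + (y + u : ℝ) * I) n *
        (1 - (w : ℂ) ^ (-(((y + u : ℝ) : ℂ) * I)))) := by
  have hn0 : (n : ℂ) ≠ 0 := by exact_mod_cast (show n ≠ 0 by omega)
  have hw0 : (w : ℂ) ≠ 0 := by exact_mod_cast (show w ≠ 0 by linarith)
  have hwpos : 0 < w := by linarith
  have hnpos : (0 : ℝ) < n := by exact_mod_cast hn
  -- the constants
  set c₁ : ℂ := a n * (n : ℂ) ^ (-((σ₀ : ℂ) + y * I)) with hc₁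
  set c₂ : ℂ := c₁ * (w : ℂ) ^ (-((y : ℂ) * I)) with hc₂
  -- splitting the powers
  have e1 : LSeries.term a (σ₀ + α + y * I) n = c₁ * (n : ℂ) ^ (-(α : ℂ)) := by
    rw [LSeries.term_of_ne_zero (by omega), div_eq_mul_inv, ← Complex.cpow_neg, hc₁, mul_assoc,
      ← Complex.cpow_add _ _ hn0]
    congr 2; ring
  have e2 : ∀ u : ℝ, LSeries.term a (σ₀ + (y + u : ℝ) * I) n = c₁ * (n : ℂ) ^ (-((u : ℂ) * I)) := by
    intro u
    rw [LSeries.term_of_ne_zero (by omega), div_eq_mul_inv, ← Complex.cpow_neg, hc₁, mul_assoc,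
      ← Complex.cpow_add _ _ hn0]
    congr 2; push_cast; ring
  have e3 : (w : ℂ) ^ (-((α : ℂ) + y * I)) = (w : ℂ) ^ (-((y : ℂ) * I)) * (w : ℂ) ^ (-(α : ℂ)) := by
    rw [← Complex.cpow_add _ _ hw0]; congr 1; ring
  have e4 : ∀ u : ℝ, (w : ℂ) ^ (-(((y + u : ℝ) : ℂ) * I)) = (w : ℂ) ^ (-((y : ℂ) * I)) * (w : ℂ) ^ (-((u : ℂ) * I)) := by
    intro u
    rw [← Complex.cpow_add _ _ hw0]; congr 1; push_cast; ring
  have e5 : (((n : ℝ) * w : ℝ) : ℂ) ^ (-(α : ℂ)) = (n : ℂ) ^ (-(α : ℂ)) * (w : ℂ) ^ (-(α : ℂ)) := by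
    rw [Complex.ofReal_mul, Complex.ofReal_natCast]
    have := Complex.mul_cpow_ofReal_nonneg hnpos.le hwpos.le (-(α : ℂ))
    rwa [Complex.ofReal_natCast] at this
  have e6 : ∀ u : ℝ, (((n : ℝ) * w : ℝ) : ℂ) ^ (-((u : ℂ) * I)) = (n : ℂ) ^ (-((u : ℂ) * I)) * (w : ℂ) ^ (-((u : ℂ) * I)) := by
    intro u
    rw [Complex.ofReal_mul, Complex.ofReal_natCast]
    have := Complex.mul_cpow_ofReal_nonneg hnpos.le hwpos.le (-((u : ℂ) * I))
    rwa [Complex.ofReal_natCast] at this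
  -- the two Poisson representations
  have i1 := PoissonSmoothing.natCast_cpow_neg_eq_integral hα hn
  have hnw : (1 : ℝ) ≤ n * w := one_le_mul_of_one_le_of_one_le (by exact_mod_cast hn) hw
  have i2 := ofReal_cpow_neg_eq_integral hα hnw
  -- integrability of the two integrands
  have hKint : Integrable (fun u : ℝ => (kernel α u : ℂ)) := (PoissonSmoothing.integrable_kernel hα).ofReal
  have hI1 : Integrable (fun u : ℝ => (kernel α u : ℂ) * (n : ℂ) ^ (-((u : ℂ) * I))) := by
    refine hKint.mul_bdd (c := 1) (Continuous.aestronglyMeasurable ?_) (Filter.Eventually.of_forall fun u => ?_)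
    · exact Continuous.const_cpow (by fun_prop) (Or.inl hn0)
    · have := norm_ofReal_cpow_neg_mul_I hnpos u
      rw [Complex.ofReal_natCast] at this
      exact this.le
  have hI2 : Integrable (fun u : ℝ => (kernel α u : ℂ) * (((n : ℝ) * w : ℝ) : ℂ) ^ (-((u : ℂ) * I))) := by
    refine hKint.mul_bdd (c := 1) (Continuous.aestronglyMeasurable ?_) (Filter.Eventually.of_forall fun u => ?_)
    · refine Continuous.const_cpow (by fun_prop) (Or.inl ?_)
      exact_mod_cast (show (n : ℝ) * w ≠ 0 by positivity)
    · exact (norm_ofReal_cpow_neg_mul_I (by positivity) u).le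
  -- assemble
  have hL : LSeries.term a (σ₀ + α + y * I) n * (1 - (w : ℂ) ^ (-((α : ℂ) + y * I))) =
      c₁ * (n : ℂ) ^ (-(α : ℂ)) - c₂ * (((n : ℝ) * w : ℝ) : ℂ) ^ (-(α : ℂ)) := by
    rw [e1, e3, e5, hc₂]; ring
  have hR : ∀ u : ℝ, (kernel α u : ℂ) * (LSeries.term a (σ₀ + (y + u : ℝ) * I) n *
        (1 - (w : ℂ) ^ (-(((y + u : ℝ) : ℂ) * I)))) =
      c₁ * ((kernel α u : ℂ) * (n : ℂ) ^ (-((u : ℂ) * I))) -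
        c₂ * ((kernel α u : ℂ) * (((n : ℝ) * w : ℝ) : ℂ) ^ (-((u : ℂ) * I))) := by
    intro u
    rw [e2, e4, e6, hc₂]; ring
  rw [hL, integral_congr_ae (Filter.Eventually.of_forall hR), integral_sub (hI1.const_mul c₁) (hI2.const_mul c₂),
    integral_const_mul, integral_const_mul, ← i1, ← i2]

omit hα in
/-- `‖L(s)(1 - w^{-it})‖ ≤ 2 ∑ ‖a_n‖ n^{-σ₀}` on the line `Re s = σ₀`. [folklore] -/
theorem norm_LSeries_twist_le_tsum {a : ℕ → ℂ} {σ₀ : ℝ}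
    (hsum : Summable fun n : ℕ => ‖a n‖ / (n : ℝ) ^ σ₀) {w : ℝ} (hw : 1 ≤ w) (t : ℝ) :
    ‖LSeries a (σ₀ + t * I) * (1 - (w : ℂ) ^ (-((t : ℂ) * I)))‖ ≤ 2 * ∑' n : ℕ, ‖a n‖ / (n : ℝ) ^ σ₀ := by
  rw [norm_mul]
  have h1 := PoissonSmoothing.norm_LSeries_le_tsum hsum t
  have h2 := norm_one_sub_cpow_neg_mul_I_le hw t
  have h0 : 0 ≤ ∑' n : ℕ, ‖a n‖ / (n : ℝ) ^ σ₀ := tsum_nonneg fun n => by positivity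
  calc ‖LSeries a (σ₀ + t * I)‖ * ‖1 - (w : ℂ) ^ (-((t : ℂ) * I))‖ ≤ (∑' n : ℕ, ‖a n‖ / (n : ℝ) ^ σ₀) * 2 :=
        mul_le_mul h1 h2 (norm_nonneg _) h0
    _ = 2 * ∑' n : ℕ, ‖a n‖ / (n : ℝ) ^ σ₀ := by ring

/-- **Granville–Soundararajan 2003, Lemma 2.2, (2.6)** (explicit-constant form): if
`∑ |a_n| n^{-σ₀} = S < ∞`, `α > 0`, `T₀ > 0`, `w ≥ 1` and `|L(σ₀ + iu)(1 - w^{-iu})| ≤ B` for all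
`|u| ≤ |y| + T₀`, then `|L(σ₀ + α + iy)(1 - w^{-α-iy})| ≤ B + 4αS/T₀` (GS:
`max_{|y| ≤ T} |A(1+α+iy)(1-w^{-α-iy})| ≤ max_{|y| ≤ 2T} |A(1+iy)(1-w^{-iy})| + O(α S/T)`).
[cite: GranvilleSoundararajan2003, Lemma 2.2, (2.6)] -/
theorem norm_LSeries_twist_le_of_bound {a : ℕ → ℂ} {σ₀ : ℝ}
    (hsum : Summable fun n : ℕ => ‖a n‖ / (n : ℝ) ^ σ₀) {T₀ : ℝ} (hT : 0 < T₀) {w : ℝ} (hw : 1 ≤ w)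
    (y : ℝ) {B : ℝ}
    (hB : ∀ u : ℝ, |u| ≤ |y| + T₀ → ‖LSeries a (σ₀ + u * I) * (1 - (w : ℂ) ^ (-((u : ℂ) * I)))‖ ≤ B) :
    ‖LSeries a (σ₀ + α + y * I) * (1 - (w : ℂ) ^ (-((α : ℂ) + y * I)))‖ ≤
      B + 4 * α / T₀ * ∑' n : ℕ, ‖a n‖ / (n : ℝ) ^ σ₀ := by
  set S : ℝ := ∑' n : ℕ, ‖a n‖ / (n : ℝ) ^ σ₀ with hS
  have hS0 : 0 ≤ S := tsum_nonneg fun n => by positivity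
  have hB0 : 0 ≤ B := (norm_nonneg _).trans (hB y (by linarith [abs_nonneg y]))
  have hw0 : 0 < w := by linarith
  -- the summands as integrals
  set F : ℕ → ℝ → ℂ := fun n u => (kernel α u : ℂ) * (LSeries.term a (σ₀ + (y + u : ℝ) * I) n *
    (1 - (w : ℂ) ^ (-(((y + u : ℝ) : ℂ) * I)))) with hF
  have htw_cont : Continuous fun u : ℝ => (1 : ℂ) - (w : ℂ) ^ (-(((y + u : ℝ) : ℂ) * I)) := by
    refine continuous_const.sub (Continuous.const_cpow (by fun_prop) (Or.inl ?_))
    exact_mod_cast hw0.ne'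
  have hFint : ∀ n, Integrable (F n) := by
    intro n
    have hcont : Continuous (F n) := by
      simp only [hF]
      exact (Complex.continuous_ofReal.comp (by
        unfold kernel; exact continuous_const.div (by fun_prop) (fun u => by positivity))).mul
        ((PoissonSmoothing.continuous_term y n).mul htw_cont)
    refine Integrable.mono' ((PoissonSmoothing.integrable_kernel hα).mul_const (‖a n‖ / (n : ℝ) ^ σ₀ * 2))
      hcont.aestronglyMeasurable (Filter.Eventually.of_forall fun u => ?_)
    simp only [hF, norm_mul, Complex.norm_real, Real.norm_of_nonneg (PoissonSmoothing.kernel_pos hα u).le]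
    refine mul_le_mul_of_nonneg_left ?_ (PoissonSmoothing.kernel_pos hα u).le
    have htw := norm_one_sub_cpow_neg_mul_I_le hw (y + u)
    rcases Nat.eq_zero_or_pos n with h0 | hn
    · subst h0; simp only [LSeries.term_zero, norm_zero, zero_mul]; positivity
    · rw [PoissonSmoothing.norm_term_line_eq _ hn]
      exact mul_le_mul_of_nonneg_left htw (by positivity)
  have hFnorm_le : ∀ n, ∫ u, ‖F n u‖ ≤ 2 * (‖a n‖ / (n : ℝ) ^ σ₀) := by
    intro n
    have hle : ∀ u, ‖F n u‖ ≤ kernel α u * (2 * (‖a n‖ / (n : ℝ) ^ σ₀)) := by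
      intro u
      simp only [hF, norm_mul, Complex.norm_real, Real.norm_of_nonneg (PoissonSmoothing.kernel_pos hα u).le]
      refine mul_le_mul_of_nonneg_left ?_ (PoissonSmoothing.kernel_pos hα u).le
      have htw := norm_one_sub_cpow_neg_mul_I_le hw (y + u)
      rcases Nat.eq_zero_or_pos n with h0 | hn
      · subst h0; simp only [LSeries.term_zero, norm_zero, zero_mul]; positivity
      · rw [PoissonSmoothing.norm_term_line_eq _ hn]
        calc ‖a n‖ / (n : ℝ) ^ σ₀ * ‖1 - (w : ℂ) ^ (-(((y + u : ℝ) : ℂ) * I))‖ ≤ ‖a n‖ / (n : ℝ) ^ σ₀ * 2 :=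
              mul_le_mul_of_nonneg_left htw (by positivity)
          _ = 2 * (‖a n‖ / (n : ℝ) ^ σ₀) := by ring
    calc ∫ u, ‖F n u‖ ≤ ∫ u, kernel α u * (2 * (‖a n‖ / (n : ℝ) ^ σ₀)) :=
          integral_mono (hFint n).norm ((PoissonSmoothing.integrable_kernel hα).mul_const _) hle
      _ = 2 * (‖a n‖ / (n : ℝ) ^ σ₀) := by rw [integral_mul_const, PoissonSmoothing.integral_kernel hα, one_mul]
  have hrepr : LSeries a (σ₀ + α + y * I) * (1 - (w : ℂ) ^ (-((α : ℂ) + y * I))) =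
      ∫ u, (kernel α u : ℂ) * (LSeries a (σ₀ + (y + u : ℝ) * I) * (1 - (w : ℂ) ^ (-(((y + u : ℝ) : ℂ) * I)))) := by
    have h1 : LSeries a (σ₀ + α + y * I) * (1 - (w : ℂ) ^ (-((α : ℂ) + y * I))) = ∑' n, ∫ u, F n u := by
      unfold LSeries
      rw [← tsum_mul_right]
      refine tsum_congr fun n => ?_
      rcases Nat.eq_zero_or_pos n with rfl | hn
      · simp [hF]
      · exact term_twist_eq_integral hα hw y hn
    rw [h1, integral_tsum_of_summable_integral_norm hFint]
    · refine integral_congr_ae (Filter.Eventually.of_forall fun u => ?_)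
      simp only [hF]
      rw [tsum_mul_left, LSeries, ← tsum_mul_right]
    · exact Summable.of_nonneg_of_le (fun n => integral_nonneg fun u => norm_nonneg _) hFnorm_le
        ((hsum.mul_left 2))
  -- the majorant
  set g : ℝ → ℝ := fun u => B * kernel α u + (2 * α / T₀ * (2 * S)) * kernel T₀ u with hg
  have hgint : Integrable g :=
    ((PoissonSmoothing.integrable_kernel hα).const_mul B).add ((PoissonSmoothing.integrable_kernel hT).const_mul _)
  have hgval : ∫ u, g u = B + 4 * α / T₀ * S := by
    simp only [hg]
    rw [integral_add ((PoissonSmoothing.integrable_kernel hα).const_mul B) ((PoissonSmoothing.integrable_kernel hT).const_mul _),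
      integral_const_mul, integral_const_mul, PoissonSmoothing.integral_kernel hα, PoissonSmoothing.integral_kernel hT]
    ring
  have hpt : ∀ u, ‖(kernel α u : ℂ) * (LSeries a (σ₀ + (y + u : ℝ) * I) *
      (1 - (w : ℂ) ^ (-(((y + u : ℝ) : ℂ) * I))))‖ ≤ g u := by
    intro u
    rw [norm_mul, Complex.norm_real, Real.norm_of_nonneg (PoissonSmoothing.kernel_pos hα u).le]
    simp only [hg]
    rcases le_or_gt |u| T₀ with hu | hu
    · have : ‖LSeries a (σ₀ + (y + u : ℝ) * I) * (1 - (w : ℂ) ^ (-(((y + u : ℝ) : ℂ) * I)))‖ ≤ B :=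
        hB (y + u) ((abs_add_le y u).trans (by linarith))
      have hk : 0 ≤ (2 * α / T₀ * (2 * S)) * kernel T₀ u := by
        have := PoissonSmoothing.kernel_pos hT u; positivity
      calc kernel α u * ‖LSeries a (σ₀ + (y + u : ℝ) * I) * (1 - (w : ℂ) ^ (-(((y + u : ℝ) : ℂ) * I)))‖
          ≤ kernel α u * B := mul_le_mul_of_nonneg_left this (PoissonSmoothing.kernel_pos hα u).le
        _ ≤ _ := by linarith
    · have hu0 : u ≠ 0 := by intro h; rw [h, abs_zero] at hu; linarith
      have hL : ‖LSeries a (σ₀ + (y + u : ℝ) * I) * (1 - (w : ℂ) ^ (-(((y + u : ℝ) : ℂ) * I)))‖ ≤ 2 * S :=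
        norm_LSeries_twist_le_tsum hsum hw _
      have hk1 := PoissonSmoothing.kernel_le_inv_sq hα u hu0
      have hu2 : T₀ ^ 2 < u ^ 2 := by
        calc T₀ ^ 2 < |u| ^ 2 := by gcongr
          _ = u ^ 2 := sq_abs u
      have hk2 : (u ^ 2)⁻¹ ≤ 2 * π / T₀ * kernel T₀ u := by
        unfold kernel
        rw [show 2 * π / T₀ * (T₀ / π / (T₀ ^ 2 + u ^ 2)) = 2 / (T₀ ^ 2 + u ^ 2) by field_simp]
        rw [inv_eq_one_div, div_le_div_iff₀ (by positivity) (by positivity)]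
        nlinarith
      have hBk : 0 ≤ B * kernel α u := mul_nonneg hB0 (PoissonSmoothing.kernel_pos hα u).le
      have h2S : 0 ≤ 2 * S := by positivity
      calc kernel α u * ‖LSeries a (σ₀ + (y + u : ℝ) * I) * (1 - (w : ℂ) ^ (-(((y + u : ℝ) : ℂ) * I)))‖
          ≤ (α / π * (u ^ 2)⁻¹) * (2 * S) := mul_le_mul hk1 hL (norm_nonneg _) (by positivity)
        _ ≤ (α / π * (2 * π / T₀ * kernel T₀ u)) * (2 * S) := by gcongr
        _ = (2 * α / T₀ * (2 * S)) * kernel T₀ u := by field_simp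
        _ ≤ _ := by linarith
  rw [hrepr]
  calc ‖∫ u, (kernel α u : ℂ) * (LSeries a (σ₀ + (y + u : ℝ) * I) * (1 - (w : ℂ) ^ (-(((y + u : ℝ) : ℂ) * I))))‖
      ≤ ∫ u, g u := norm_integral_le_of_norm_le hgint (Filter.Eventually.of_forall hpt)
    _ = B + 4 * α / T₀ * S := hgval

end TwistedSmoothing

end GranvilleSoundararajan

end Literature.NumberTheory.LFunctions
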